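import Mathlib
import Literature.Analysis.FluidPDE.PeriodicNSOrbitPersistsProofs
import Literature.Analysis.FluidPDE.GalerkinFlow
import Summits.AnomalousDissipation.AnomalousDissipation.Theorems.WazewskiBlockUniformWorkFloorTrapStubCoeffCurveODETools
import HarnessLib

/-!
# Route `WazewskiBlock`, crux `UniformWorkFloorTrap` (stmt-AnomalousDissipation-10353), line
# `work-lipschitz-cycles`: the truncated lattice equation summed in time (for `stub_coeffCurveODE`)

Definition-free helper file (lead a1), sequel of `…StubCoeffCurveODETools`.  For a lattice
family `c(n,k)` on `ℤ × ℤ³` with rapidly decaying extension, vanishing on the zero spatial modes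
and off the ball `|k|² ≤ N²`, and solving the spatially TRUNCATED projected space–time lattice
equation `(2πiωn + 4π²ν|k|²) c(n,k) + Π_k N(c,c)(n,k) = [n = 0] f̂(k)` on `0 < |k|² ≤ N²`:

* `lattice_eq_pointwise`, `lattice_eq_timeSum` — the equation solved for `(2πiωn) c(n,k)` on the
  whole ball and summed against `eₙ(x)`:
  `∑ₙ eₙ (2πiωn) c(n,k) = −4π²ν|k|² 𝐚(k) − Π_k ∑ₙ eₙ N(c,c)(n,k) + f̂(k)`, `𝐚(l) = ∑ₙ eₙ c(n,l)`;
* `nl_apply_eq_sum_convolution`, `summable_norm_nl_fibre`, `tsum_fourier_smul_nl_eq_convectionCoeff`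
  — `N(c,c)(n,k)` is a finite sum of convolutions on `ℤ`, absolutely summable in `n`, with time
  sum the Galerkin convection symbol `Torus.convectionCoeff (freqBall N) 𝐚 𝐚 (k)`.
References: Constantin–Foias 1988, Ch. 8, (8.5); Grafakos 2014, §3.3.3.
-/

noncomputable section

-- `Summit.<Summit>.<Problem>`: single-conjunct summit, the duplicate namespace is mandated (CONVENTIONS §2).
set_option linter.dupNamespace false

namespace Summit.AnomalousDissipation.AnomalousDissipation.Theorems.UniformWorkFloorTrap.WorkLipschitzCycles

open scoped Topology ComplexConjugate
open Filter Set Function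
open Literature.Analysis.FunctionSpaces Literature.Analysis.FunctionSpaces.Torus

/-! ## §1 Time sums of lattice families -/

section Lattice

open MeasureTheory UnitAddTorus
open scoped ENNReal
open Literature.Analysis.FunctionSpaces.EuclideanSpace
open Literature.Analysis.FluidPDE Literature.Analysis.FluidPDE.ScalarFourier
open Literature.Analysis.FluidPDE.TimePeriodicLattice

variable {c : ℤ × (Fin 3 → ℤ) → EuclideanSpace ℂ (Fin 3)}

/-- Components of a vector-valued Fourier series in time: `(∑ₙ eₙ • vₙ)ₚ = ∑ₙ eₙ (vₙ)ₚ` for an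
absolutely summable family. [folklore] -/
theorem tsum_fourier_smul_apply {v : ℤ → EuclideanSpace ℂ (Fin 3)} (hv : Summable fun n => ‖v n‖)
    (x : UnitAddCircle) (p : Fin 3) :
    (∑' n : ℤ, (fourier n x : ℂ) • v n) p = ∑' n : ℤ, (fourier n x : ℂ) * v n p := by
  have hs : Summable fun n : ℤ => (fourier n x : ℂ) • v n :=
    Summable.of_norm (by simpa only [norm_fourier_smul] using hv)
  have h := (EuclideanSpace.proj p : EuclideanSpace ℂ (Fin 3) →L[ℂ] ℂ).map_tsum hs
  simp only [PiLp.proj_apply, PiLp.smul_apply, smul_eq_mul] at h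
  exact h

/-- The time sums vanish off the ball when the family does. [folklore] -/
theorem tsum_fourier_smul_eq_zero_of_forall {l : Fin 3 → ℤ} (hl : ∀ n : ℤ, c (n, l) = 0) (x : UnitAddCircle) :
    (fun l : Fin 3 → ℤ => ∑' n : ℤ, (fourier n x : ℂ) • c (n, l)) l = 0 := by
  simp only [hl, smul_zero, tsum_zero]

/-- **The extension by zero of the restricted time sums is the full family of time sums** when `c`
vanishes off the ball `|k|² ≤ N²`. [folklore] -/
theorem coeffExt_timeSum_eq {N : ℕ} (hcN : ∀ m : ℤ × (Fin 3 → ℤ), (N : ℝ) ^ 2 < freqNormSq m.2 → c m = 0)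
    (x : UnitAddCircle) :
    coeffExt (freqBall N) (fun k : ↥(freqBall (d := Fin 3) N) => (fun l : Fin 3 → ℤ => ∑' n : ℤ, (fourier n x : ℂ) • c (n, l)) (k : Fin 3 → ℤ)) = (fun l : Fin 3 → ℤ => ∑' n : ℤ, (fourier n x : ℂ) • c (n, l)) := by
  funext l
  by_cases hl : l ∈ freqBall N
  · rw [coeffExt_of_mem _ hl]
  · rw [coeffExt_of_not_mem _ hl]
    exact (tsum_fourier_smul_eq_zero_of_forall (fun n => hcN (n, l) (not_mem_freqBall.1 hl)) x).symm

/-! ### The lattice equation summed in time -/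

/-- **Fourier coefficients of a mean-zero field vanish at the zero mode.** [folklore] -/
theorem mFourierCoeff_zero_of_hasZeroMean {f : UnitAddTorus (Fin 3) → EuclideanSpace ℝ (Fin 3)} (hf : IsSmooth f)
    (hf0 : HasZeroMean f) : mFourierCoeff (complexify ∘ f) 0 = 0 := by
  rw [mFourierCoeff_zero_eq_integral_of_normedSpace]
  have h1 : (∫ x, (complexify ∘ f) x) = complexify (∫ x, f x) := by
    simp only [Function.comp_apply]
    exact (complexify.toContinuousLinearMap.integral_comp_comm hf.integrable)
  rw [h1, show (∫ x, f x) = 0 from hf0, map_zero]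

variable {N : ℕ} {ω ν : ℝ} {f : UnitAddTorus (Fin 3) → EuclideanSpace ℝ (Fin 3)}

/-- **The truncated lattice equation, solved for the time derivative, on the whole ball**
(including `k = 0`, where every term vanishes: `c(n,0) = 0`, `N(c,c)(n,0) = 0` by
transversality, `Π₀ = 0`, `f̂(0) = 0`). [folklore] -/
theorem lattice_eq_pointwise (hf : IsGalerkinMode N f) (hf0 : HasZeroMean f)
    (hc0 : ∀ n : ℤ, c (n, 0) = 0)
    (hct : ∀ m : ℤ × (Fin 3 → ℤ), (∑ jj : Fin 3, ((m.2 jj : ℤ) : ℂ) * (c m) jj) = 0)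
    (hcr : RapidDecay ((fun K : Fin 4 → ℤ => c ((K 0, Fin.tail K) : ℤ × (Fin 3 → ℤ)))))
    (heq : ∀ m : ℤ × (Fin 3 → ℤ), m.2 ≠ 0 → freqNormSq m.2 ≤ (N : ℝ) ^ 2 →
      (2 * Real.pi * Complex.I * (ω : ℂ) * (m.1 : ℂ) + ((4 * Real.pi ^ 2 * ν * freqNormSq m.2 : ℝ) : ℂ)) • c m +
        Torus.lerayCoeff m.2 ((WithLp.toLp 2 (fun p : Fin 3 => ∑ j : Fin 3, ∑' m' : ℤ × (Fin 3 → ℤ), c m' j * (dsym j (Prod.snd m - Prod.snd m') * c (m - m') p)) : EuclideanSpace ℂ (Fin 3))) = if m.1 = 0 then mFourierCoeff (complexify ∘ f) m.2 else 0)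
    {k : Fin 3 → ℤ} (hk : freqNormSq k ≤ (N : ℝ) ^ 2) (n : ℤ) :
    (2 * Real.pi * Complex.I * ω * n) • c (n, k) =
      -(((4 * Real.pi ^ 2 * ν * freqNormSq k : ℝ) : ℂ) • c (n, k)) - Torus.lerayCoeff k ((WithLp.toLp 2 (fun p : Fin 3 => ∑ j : Fin 3, ∑' m' : ℤ × (Fin 3 → ℤ), c m' j * (dsym j (Prod.snd (n, k) - Prod.snd m') * c ((n, k) - m') p)) : EuclideanSpace ℂ (Fin 3))) +
        (if n = 0 then mFourierCoeff (complexify ∘ f) k else 0) := by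
  by_cases hk0 : k = 0
  · subst hk0
    have hN0 : (WithLp.toLp 2 (fun p : Fin 3 => ∑ j : Fin 3, ∑' m' : ℤ × (Fin 3 → ℤ), c m' j * (dsym j (Prod.snd ((n, 0) : ℤ × (Fin 3 → ℤ)) - Prod.snd m') * c (((n, 0) : ℤ × (Fin 3 → ℤ)) - m') p)) : EuclideanSpace ℂ (Fin 3)) = 0 := nl_cons_zero_of_rapidDecayE hct hcr hcr n
    rw [hc0 n, hN0, Torus.lerayCoeff_zero, mFourierCoeff_zero_of_hasZeroMean hf.isSmooth hf0]
    simp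
  · have he := heq (n, k) hk0 hk
    simp only at he
    have : (2 * Real.pi * Complex.I * (ω : ℂ) * (n : ℂ)) • c (n, k) =
        (if n = 0 then mFourierCoeff (complexify ∘ f) k else 0) - ((4 * Real.pi ^ 2 * ν * freqNormSq k : ℝ) : ℂ) • c (n, k) -
          Torus.lerayCoeff k ((WithLp.toLp 2 (fun p : Fin 3 => ∑ j : Fin 3, ∑' m' : ℤ × (Fin 3 → ℤ), c m' j * (dsym j (Prod.snd (n, k) - Prod.snd m') * c ((n, k) - m') p)) : EuclideanSpace ℂ (Fin 3))) := by
      rw [← he, add_smul]; abel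
    rw [this]; abel

/-- **Summability of the four time series at a fixed spatial mode** (rapid decay). [folklore] -/
theorem summable_timeSeries (hcr : RapidDecay ((fun K : Fin 4 → ℤ => c ((K 0, Fin.tail K) : ℤ × (Fin 3 → ℤ))))) (x : UnitAddCircle) (k : Fin 3 → ℤ) :
    (Summable fun n : ℤ => (fourier n x : ℂ) • c (n, k)) ∧
    (Summable fun n : ℤ => (fourier n x : ℂ) • ((2 * Real.pi * Complex.I * ω * n) • c (n, k))) ∧
    (Summable fun n : ℤ => (fourier n x : ℂ) • (((4 * Real.pi ^ 2 * ν * freqNormSq k : ℝ) : ℂ) • c (n, k))) := by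
  obtain ⟨-, hfib, hfib1⟩ := summable_fibre_of_rapidDecayE hcr
  refine ⟨Summable.of_norm (by simpa only [norm_fourier_smul] using hfib k), ?_, ?_⟩
  · refine Summable.of_norm ?_
    simp only [norm_smul, norm_fourier_apply, one_mul]
    have : ∀ n : ℤ, ‖(2 * Real.pi * Complex.I * ω * n : ℂ)‖ * ‖c (n, k)‖ = 2 * Real.pi * |ω| * (‖((n : ℤ) : ℂ)‖ * ‖c (n, k)‖) := by
      intro n
      rw [norm_mul, norm_mul, norm_mul, norm_mul, Complex.norm_I, mul_one, Complex.norm_real, Complex.norm_ofNat,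
        Complex.norm_real, Real.norm_of_nonneg Real.pi_pos.le, Real.norm_eq_abs]
      ring
    simp only [this]
    exact (hfib1 k).mul_left _
  · refine Summable.of_norm ?_
    simp only [norm_smul, norm_fourier_apply, one_mul]
    exact (hfib k).mul_left _

/-- **The Leray multiplier commutes with absolutely convergent sums** (it is linear on `ℂ³`). [folklore] -/
theorem lerayCoeff_tsum {v : ℤ → EuclideanSpace ℂ (Fin 3)} (hv : Summable v) (k : Fin 3 → ℤ) :
    Torus.lerayCoeff k (∑' n, v n) = ∑' n, Torus.lerayCoeff k (v n) := by
  by_cases hk : k = 0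
  · subst hk; simp
  · simp only [Torus.lerayCoeff_of_ne_zero hk]
    have hL : ∀ w, Torus.leraySym k w = (LinearMap.toContinuousLinearMap (Torus.leraySymₗ (d := Fin 3) k)) w :=
      fun w => rfl
    rw [hL, ContinuousLinearMap.map_tsum _ hv]
    exact tsum_congr fun n => (hL _).symm

/-- **The lattice equation summed in time**: at every mode of the ball,
`∑ₙ eₙ (2πiωn) c(n,k) = −4π²ν|k|² 𝐚(k) − Π_k ∑ₙ eₙ N(c,c)(n,k) + f̂(k)`, provided the symbol
series `n ↦ N(c,c)(n,k)` is summable. [folklore] -/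
theorem lattice_eq_timeSum (hf : IsGalerkinMode N f) (hf0 : HasZeroMean f)
    (hc0 : ∀ n : ℤ, c (n, 0) = 0)
    (hct : ∀ m : ℤ × (Fin 3 → ℤ), (∑ jj : Fin 3, ((m.2 jj : ℤ) : ℂ) * (c m) jj) = 0)
    (hcr : RapidDecay ((fun K : Fin 4 → ℤ => c ((K 0, Fin.tail K) : ℤ × (Fin 3 → ℤ)))))
    (heq : ∀ m : ℤ × (Fin 3 → ℤ), m.2 ≠ 0 → freqNormSq m.2 ≤ (N : ℝ) ^ 2 →
      (2 * Real.pi * Complex.I * (ω : ℂ) * (m.1 : ℂ) + ((4 * Real.pi ^ 2 * ν * freqNormSq m.2 : ℝ) : ℂ)) • c m +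
        Torus.lerayCoeff m.2 ((WithLp.toLp 2 (fun p : Fin 3 => ∑ j : Fin 3, ∑' m' : ℤ × (Fin 3 → ℤ), c m' j * (dsym j (Prod.snd m - Prod.snd m') * c (m - m') p)) : EuclideanSpace ℂ (Fin 3))) = if m.1 = 0 then mFourierCoeff (complexify ∘ f) m.2 else 0)
    {k : Fin 3 → ℤ} (hk : freqNormSq k ≤ (N : ℝ) ^ 2) (x : UnitAddCircle)
    (hNs : Summable fun n : ℤ => ‖(WithLp.toLp 2 (fun p : Fin 3 => ∑ j : Fin 3, ∑' m' : ℤ × (Fin 3 → ℤ), c m' j * (dsym j (Prod.snd (n, k) - Prod.snd m') * c ((n, k) - m') p)) : EuclideanSpace ℂ (Fin 3))‖) :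
    (∑' n : ℤ, (fourier n x : ℂ) • ((2 * Real.pi * Complex.I * ω * n) • c (n, k))) =
      -(((4 * Real.pi ^ 2 * ν * freqNormSq k : ℝ) : ℂ) • (fun l : Fin 3 → ℤ => ∑' n : ℤ, (fourier n x : ℂ) • c (n, l)) k)
        - Torus.lerayCoeff k (∑' n : ℤ, (fourier n x : ℂ) • (WithLp.toLp 2 (fun p : Fin 3 => ∑ j : Fin 3, ∑' m' : ℤ × (Fin 3 → ℤ), c m' j * (dsym j (Prod.snd (n, k) - Prod.snd m') * c ((n, k) - m') p)) : EuclideanSpace ℂ (Fin 3)))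
        + mFourierCoeff (complexify ∘ f) k := by
  obtain ⟨hs0, -, hs2⟩ := summable_timeSeries (ω := ω) (ν := ν) hcr x k
  -- the force series has a single term
  have hF : (∑' n : ℤ, (fourier n x : ℂ) • (if n = 0 then mFourierCoeff (complexify ∘ f) k else 0)) =
      mFourierCoeff (complexify ∘ f) k := by
    rw [tsum_eq_single 0]
    · simp
    · intro n hn; simp [hn]
  have hsF : Summable fun n : ℤ => (fourier n x : ℂ) • (if n = 0 then mFourierCoeff (complexify ∘ f) k else 0) := by
    refine summable_of_ne_finset_zero (s := {0}) fun n hn => ?_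
    rw [Finset.mem_singleton] at hn
    simp [hn]
  have hNs' : Summable fun n : ℤ => (fourier n x : ℂ) • (WithLp.toLp 2 (fun p : Fin 3 => ∑ j : Fin 3, ∑' m' : ℤ × (Fin 3 → ℤ), c m' j * (dsym j (Prod.snd (n, k) - Prod.snd m') * c ((n, k) - m') p)) : EuclideanSpace ℂ (Fin 3)) :=
    Summable.of_norm (by simpa only [norm_fourier_smul] using hNs)
  have hsL : Summable fun n : ℤ => (fourier n x : ℂ) • Torus.lerayCoeff k ((WithLp.toLp 2 (fun p : Fin 3 => ∑ j : Fin 3, ∑' m' : ℤ × (Fin 3 → ℤ), c m' j * (dsym j (Prod.snd (n, k) - Prod.snd m') * c ((n, k) - m') p)) : EuclideanSpace ℂ (Fin 3))) := by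
    refine Summable.of_norm (Summable.of_nonneg_of_le (fun n => norm_nonneg _) (fun n => ?_) hNs)
    rw [norm_fourier_smul]
    exact SteadyLattice.norm_lerayCoeff_le _ _
  calc (∑' n : ℤ, (fourier n x : ℂ) • ((2 * Real.pi * Complex.I * ω * n) • c (n, k)))
      = ∑' n : ℤ, (-((fourier n x : ℂ) • ((((4 * Real.pi ^ 2 * ν * freqNormSq k : ℝ) : ℂ) • c (n, k))))
          - (fourier n x : ℂ) • Torus.lerayCoeff k ((WithLp.toLp 2 (fun p : Fin 3 => ∑ j : Fin 3, ∑' m' : ℤ × (Fin 3 → ℤ), c m' j * (dsym j (Prod.snd (n, k) - Prod.snd m') * c ((n, k) - m') p)) : EuclideanSpace ℂ (Fin 3)))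
          + (fourier n x : ℂ) • (if n = 0 then mFourierCoeff (complexify ∘ f) k else 0)) := by
        refine tsum_congr fun n => ?_
        rw [lattice_eq_pointwise hf hf0 hc0 hct hcr heq hk n, smul_add, smul_sub, smul_neg]
    _ = -(∑' n : ℤ, (fourier n x : ℂ) • ((((4 * Real.pi ^ 2 * ν * freqNormSq k : ℝ) : ℂ) • c (n, k))))
          - (∑' n : ℤ, (fourier n x : ℂ) • Torus.lerayCoeff k ((WithLp.toLp 2 (fun p : Fin 3 => ∑ j : Fin 3, ∑' m' : ℤ × (Fin 3 → ℤ), c m' j * (dsym j (Prod.snd (n, k) - Prod.snd m') * c ((n, k) - m') p)) : EuclideanSpace ℂ (Fin 3))))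
          + ∑' n : ℤ, (fourier n x : ℂ) • (if n = 0 then mFourierCoeff (complexify ∘ f) k else 0) := by
        rw [(hs2.neg.sub hsL).tsum_add hsF, hs2.neg.tsum_sub hsL, tsum_neg]
    _ = _ := by
        rw [hF]
        congr 2
        · -- the viscous series
          rw [← hs0.tsum_const_smul (((4 * Real.pi ^ 2 * ν * freqNormSq k : ℝ) : ℂ))]
          exact congrArg Neg.neg (tsum_congr fun n => by rw [smul_comm])
        · -- the projected convective series
          rw [lerayCoeff_tsum hNs']
          refine tsum_congr fun n => ?_
          by_cases hk0 : k = 0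
          · subst hk0; simp
          · simp only [Torus.lerayCoeff_of_ne_zero hk0, Torus.leraySym_smul]


/-! ### The time sum of the lattice convolution is the Galerkin convection symbol -/

/-- `‖v‖ ≤ ∑ₚ ‖vₚ‖` on `ℂ³` (expansion in the standard orthonormal basis). [folklore] -/
theorem norm_le_sum_norm_apply (v : EuclideanSpace ℂ (Fin 3)) : ‖v‖ ≤ ∑ p : Fin 3, ‖v p‖ := by
  have h := (EuclideanSpace.basisFun (Fin 3) ℂ).sum_repr v
  simp only [EuclideanSpace.basisFun_repr] at h
  calc ‖v‖ = ‖∑ p : Fin 3, v p • (EuclideanSpace.basisFun (Fin 3) ℂ) p‖ := by rw [h]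
    _ ≤ ∑ p : Fin 3, ‖v p • (EuclideanSpace.basisFun (Fin 3) ℂ) p‖ := norm_sum_le _ _
    _ = ∑ p : Fin 3, ‖v p‖ := by
        refine Finset.sum_congr rfl fun p _ => ?_
        rw [norm_smul, (EuclideanSpace.basisFun (Fin 3) ℂ).norm_eq_one p, mul_one]

/-- Componentwise norm summability on the fibres: `∑ₙ ‖c(n,l)ⱼ‖ < ∞`. [folklore] -/
theorem summable_norm_apply_fibre (hcr : RapidDecay ((fun K : Fin 4 → ℤ => c ((K 0, Fin.tail K) : ℤ × (Fin 3 → ℤ))))) (l : Fin 3 → ℤ) (j : Fin 3) :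
    Summable fun n : ℤ => ‖c (n, l) j‖ := by
  obtain ⟨-, hfib, -⟩ := summable_fibre_of_rapidDecayE hcr
  exact Summable.of_nonneg_of_le (fun n => norm_nonneg _) (fun n => PiLp.norm_apply_le (c (n, l)) j) (hfib l)

/-- **Components of the lattice convolution at a mode of the ball, as a finite sum of
convolutions on `ℤ`**: `N(c,c)(n,k)ₚ = ∑ⱼ ∑_{l ∈ S} 2πi(k−l)ⱼ ∑ₙ' c(n',l)ⱼ c(n−n',k−l)ₚ` for `c`
vanishing off the ball `S = {|l|² ≤ N²}`. [folklore] -/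
theorem nl_apply_eq_sum_convolution {N : ℕ} (hcN : ∀ m : ℤ × (Fin 3 → ℤ), (N : ℝ) ^ 2 < freqNormSq m.2 → c m = 0)
    (hcr : RapidDecay ((fun K : Fin 4 → ℤ => c ((K 0, Fin.tail K) : ℤ × (Fin 3 → ℤ))))) (k : Fin 3 → ℤ) (n : ℤ) (p : Fin 3) :
    ((WithLp.toLp 2 (fun p : Fin 3 => ∑ j : Fin 3, ∑' m' : ℤ × (Fin 3 → ℤ), c m' j * (dsym j (Prod.snd (n, k) - Prod.snd m') * c ((n, k) - m') p)) : EuclideanSpace ℂ (Fin 3))) p = ∑ j : Fin 3, ∑ l ∈ freqBall N,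
      dsym j (k - l) * ∑' n' : ℤ, c (n', l) j * c (n - n', k - l) p := by
  rw [nl_apply]
  refine Finset.sum_congr rfl fun j _ => ?_
  -- the summable family on `ℤ × ℤ³` and its swap to `ℤ³ × ℤ`
  have hF : Summable fun m' : ℤ × (Fin 3 → ℤ) => c m' j * (dsym j (k - m'.2) * c ((n, k) - m') p) :=
    summable_nl_term_of_rapidDecayE hcr hcr (n, k) j p
  have hF' : Summable fun q : (Fin 3 → ℤ) × ℤ => c (q.2, q.1) j * (dsym j (k - q.1) * c (n - q.2, k - q.1) p) := by
    have := (Equiv.prodComm (Fin 3 → ℤ) ℤ).summable_iff.2 hF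
    refine this.congr fun q => ?_
    obtain ⟨l, n'⟩ := q
    rfl
  calc ∑' m' : ℤ × (Fin 3 → ℤ), c m' j * (dsym j ((n, k).2 - m'.2) * c ((n, k) - m') p)
      = ∑' q : (Fin 3 → ℤ) × ℤ, c (q.2, q.1) j * (dsym j (k - q.1) * c (n - q.2, k - q.1) p) := by
        rw [← (Equiv.prodComm (Fin 3 → ℤ) ℤ).tsum_eq]
        refine tsum_congr fun q => ?_
        obtain ⟨l, n'⟩ := q
        rfl
    _ = ∑' l : Fin 3 → ℤ, ∑' n' : ℤ, c (n', l) j * (dsym j (k - l) * c (n - n', k - l) p) := by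
        have h := hF'.tsum_prod
        exact h
    _ = ∑ l ∈ freqBall N, ∑' n' : ℤ, c (n', l) j * (dsym j (k - l) * c (n - n', k - l) p) := by
        refine tsum_eq_sum fun l hl => ?_
        have : ∀ n' : ℤ, c (n', l) = 0 := fun n' => hcN (n', l) (not_mem_freqBall.1 hl)
        simp only [this, PiLp.zero_apply, zero_mul, tsum_zero]
    _ = ∑ l ∈ freqBall N, dsym j (k - l) * ∑' n' : ℤ, c (n', l) j * c (n - n', k - l) p := by
        refine Finset.sum_congr rfl fun l _ => ?_
        rw [← tsum_mul_left]
        exact tsum_congr fun n' => by ring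

/-- **The symbol series is absolutely summable in time** at every mode: `∑ₙ ‖N(c,c)(n,k)‖ < ∞`
(finite sum of convolutions of `ℓ¹(ℤ)` sequences). [folklore] -/
theorem summable_norm_nl_fibre {N : ℕ} (hcN : ∀ m : ℤ × (Fin 3 → ℤ), (N : ℝ) ^ 2 < freqNormSq m.2 → c m = 0)
    (hcr : RapidDecay ((fun K : Fin 4 → ℤ => c ((K 0, Fin.tail K) : ℤ × (Fin 3 → ℤ))))) (k : Fin 3 → ℤ) :
    Summable fun n : ℤ => ‖(WithLp.toLp 2 (fun p : Fin 3 => ∑ j : Fin 3, ∑' m' : ℤ × (Fin 3 → ℤ), c m' j * (dsym j (Prod.snd (n, k) - Prod.snd m') * c ((n, k) - m') p)) : EuclideanSpace ℂ (Fin 3))‖ := by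
  -- each convolution is `ℓ¹` in `n`
  have hconv : ∀ (j p : Fin 3) (l : Fin 3 → ℤ),
      Summable fun n : ℤ => ‖∑' n' : ℤ, c (n', l) j * c (n - n', k - l) p‖ :=
    fun j p l => (summable_convolution_int (summable_norm_apply_fibre hcr l j) (summable_norm_apply_fibre hcr (k - l) p)).2.2
  have hcomp : ∀ p : Fin 3, Summable fun n : ℤ => ‖((WithLp.toLp 2 (fun p : Fin 3 => ∑ j : Fin 3, ∑' m' : ℤ × (Fin 3 → ℤ), c m' j * (dsym j (Prod.snd (n, k) - Prod.snd m') * c ((n, k) - m') p)) : EuclideanSpace ℂ (Fin 3))) p‖ := by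
    intro p
    have hmaj : Summable fun n : ℤ => ∑ j : Fin 3, ∑ l ∈ freqBall N,
        ‖dsym j (k - l)‖ * ‖∑' n' : ℤ, c (n', l) j * c (n - n', k - l) p‖ :=
      summable_sum fun j _ => summable_sum fun l _ => (hconv j p l).mul_left _
    refine Summable.of_nonneg_of_le (fun n => norm_nonneg _) (fun n => ?_) hmaj
    rw [nl_apply_eq_sum_convolution hcN hcr k n p]
    refine (norm_sum_le _ _).trans (Finset.sum_le_sum fun j _ => ?_)
    refine (norm_sum_le _ _).trans (Finset.sum_le_sum fun l _ => ?_)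
    rw [norm_mul]
  refine Summable.of_nonneg_of_le (fun n => norm_nonneg _) (fun n => norm_le_sum_norm_apply _) ?_
  exact summable_sum fun p _ => hcomp p

/-- **Components of the Galerkin convection symbol.** [folklore] -/
theorem convectionCoeff_apply_eq {N : ℕ} {A : (Fin 3 → ℤ) → EuclideanSpace ℂ (Fin 3)}
    (hA : ∀ l, l ∉ freqBall N → A l = 0) (k : Fin 3 → ℤ) (p : Fin 3) :
    (Torus.convectionCoeff (freqBall N) A A k) p =
      ∑ l ∈ freqBall N, ∑ j : Fin 3, A l j * dsym j (k - l) * A (k - l) p := by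
  rw [Torus.convectionCoeff_def, WithLp.ofLp_sum, Finset.sum_apply]
  refine Finset.sum_congr rfl fun l _ => ?_
  rw [WithLp.ofLp_sum, Finset.sum_apply]
  -- the inner sum has at most the term `m = k - l`
  have h1 : (∑ m ∈ freqBall N, (if l + m = k then ((2 * Real.pi * Complex.I * ∑ j : Fin 3, A l j * (m j : ℂ)) • A m) else 0) p) =
      ∑ m ∈ freqBall N, (if k - l = m then (2 * Real.pi * Complex.I * ∑ j : Fin 3, A l j * (m j : ℂ)) * A m p else 0) := by
    refine Finset.sum_congr rfl fun m _ => ?_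
    by_cases h : l + m = k
    · have h' : k - l = m := by rw [← h]; abel
      rw [if_pos h, if_pos h', PiLp.smul_apply, smul_eq_mul]
    · have h' : ¬ (k - l = m) := fun h' => h (by rw [← h']; abel)
      rw [if_neg h, if_neg h']
      rfl
  rw [h1, Finset.sum_ite_eq]
  have hval : (2 * Real.pi * Complex.I * ∑ j : Fin 3, A l j * ((k - l) j : ℂ)) * A (k - l) p =
      ∑ j : Fin 3, A l j * dsym j (k - l) * A (k - l) p := by
    rw [Finset.mul_sum, Finset.sum_mul]
    refine Finset.sum_congr rfl fun j _ => ?_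
    rw [dsym_apply]; ring
  by_cases hmem : k - l ∈ freqBall N
  · rw [if_pos hmem, ← hval]
  · rw [if_neg hmem, hA _ hmem]
    simp

/-- **The time sum of the lattice convolution is the Galerkin convection symbol of the time sums**:
`∑ₙ eₙ(x) N(c,c)(n,k) = convectionCoeff S 𝐚 𝐚 (k)` with `𝐚(l) = ∑ₙ eₙ(x) c(n,l)` — the Cauchy
product of the time series, mode by mode (the quadratic term of the Galerkin system,
Constantin–Foias 1988, (8.5), read on the space–time lattice). [folklore] -/
theorem tsum_fourier_smul_nl_eq_convectionCoeff {N : ℕ}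
    (hcN : ∀ m : ℤ × (Fin 3 → ℤ), (N : ℝ) ^ 2 < freqNormSq m.2 → c m = 0)
    (hcr : RapidDecay ((fun K : Fin 4 → ℤ => c ((K 0, Fin.tail K) : ℤ × (Fin 3 → ℤ))))) (x : UnitAddCircle) (k : Fin 3 → ℤ) :
    (∑' n : ℤ, (fourier n x : ℂ) • (WithLp.toLp 2 (fun p : Fin 3 => ∑ j : Fin 3, ∑' m' : ℤ × (Fin 3 → ℤ), c m' j * (dsym j (Prod.snd (n, k) - Prod.snd m') * c ((n, k) - m') p)) : EuclideanSpace ℂ (Fin 3))) = Torus.convectionCoeff (freqBall N) (fun l : Fin 3 → ℤ => ∑' n : ℤ, (fourier n x : ℂ) • c (n, l)) (fun l : Fin 3 → ℤ => ∑' n : ℤ, (fourier n x : ℂ) • c (n, l)) k := by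
  obtain ⟨-, hfib, -⟩ := summable_fibre_of_rapidDecayE hcr
  have hA : ∀ l, l ∉ freqBall N → (fun l : Fin 3 → ℤ => ∑' n : ℤ, (fourier n x : ℂ) • c (n, l)) l = 0 := fun l hl =>
    tsum_fourier_smul_eq_zero_of_forall (fun n => hcN (n, l) (not_mem_freqBall.1 hl)) x
  ext p
  rw [tsum_fourier_smul_apply (summable_norm_nl_fibre hcN hcr k) x p, convectionCoeff_apply_eq hA k p]
  -- expand the components and exchange the sums
  have hconv : ∀ (j q : Fin 3) (l : Fin 3 → ℤ),
      Summable fun n : ℤ => ‖∑' n' : ℤ, c (n', l) j * c (n - n', k - l) q‖ :=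
    fun j q l => (summable_convolution_int (summable_norm_apply_fibre hcr l j) (summable_norm_apply_fibre hcr (k - l) q)).2.2
  have hterm : ∀ (j : Fin 3) (l : Fin 3 → ℤ), Summable fun n : ℤ =>
      (fourier n x : ℂ) * (dsym j (k - l) * ∑' n' : ℤ, c (n', l) j * c (n - n', k - l) p) := by
    intro j l
    refine Summable.of_norm ?_
    refine ((hconv j p l).mul_left ‖dsym j (k - l)‖).congr fun n => ?_
    rw [norm_fourier_mul, norm_mul]
  calc ∑' n : ℤ, (fourier n x : ℂ) * ((WithLp.toLp 2 (fun p : Fin 3 => ∑ j : Fin 3, ∑' m' : ℤ × (Fin 3 → ℤ), c m' j * (dsym j (Prod.snd (n, k) - Prod.snd m') * c ((n, k) - m') p)) : EuclideanSpace ℂ (Fin 3))) p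
      = ∑' n : ℤ, ∑ j : Fin 3, ∑ l ∈ freqBall N,
          (fourier n x : ℂ) * (dsym j (k - l) * ∑' n' : ℤ, c (n', l) j * c (n - n', k - l) p) := by
        refine tsum_congr fun n => ?_
        rw [nl_apply_eq_sum_convolution hcN hcr k n p, Finset.mul_sum]
        exact Finset.sum_congr rfl fun j _ => by rw [Finset.mul_sum]
    _ = ∑ j : Fin 3, ∑ l ∈ freqBall N, ∑' n : ℤ,
          (fourier n x : ℂ) * (dsym j (k - l) * ∑' n' : ℤ, c (n', l) j * c (n - n', k - l) p) := by
        rw [Summable.tsum_finsetSum (fun j _ => summable_sum fun l _ => hterm j l)]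
        exact Finset.sum_congr rfl fun j _ => Summable.tsum_finsetSum fun l _ => hterm j l
    _ = ∑ j : Fin 3, ∑ l ∈ freqBall N, dsym j (k - l) * (((fun l : Fin 3 → ℤ => ∑' n : ℤ, (fourier n x : ℂ) • c (n, l)) l) j * ((fun l : Fin 3 → ℤ => ∑' n : ℤ, (fourier n x : ℂ) • c (n, l)) (k - l)) p) := by
        refine Finset.sum_congr rfl fun j _ => Finset.sum_congr rfl fun l _ => ?_
        have hprod := tsum_fourier_mul_tsum_fourier_mul (summable_norm_apply_fibre hcr l j)
          (summable_norm_apply_fibre hcr (k - l) p) x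
        simp only
        rw [tsum_fourier_smul_apply (hfib l) x j, tsum_fourier_smul_apply (hfib (k - l)) x p, hprod, ← tsum_mul_left]
        exact tsum_congr fun n => by ring
    _ = ∑ l ∈ freqBall N, ∑ j : Fin 3, ((fun l : Fin 3 → ℤ => ∑' n : ℤ, (fourier n x : ℂ) • c (n, l)) l) j * dsym j (k - l) * ((fun l : Fin 3 → ℤ => ∑' n : ℤ, (fourier n x : ℂ) • c (n, l)) (k - l)) p := by
        rw [Finset.sum_comm]
        exact Finset.sum_congr rfl fun l _ => Finset.sum_congr rfl fun j _ => by ring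



/-! ## §4 Registered tools stub -/

/-- **Registered tools stub** `stub_coeffCurveODELattice` (line `work-lipschitz-cycles`, crux
`WazewskiBlock.UniformWorkFloorTrap`, stmt-AnomalousDissipation-10353): absolute summability in time
of the lattice convolution at every mode of the ball, and the identification of its time sum with
the Galerkin convection symbol of the time sums. [folklore] -/
theorem stub_coeffCurveODELattice :
    (∀ {c : ℤ × (Fin 3 → ℤ) → EuclideanSpace ℂ (Fin 3)} {N : ℕ},
      (∀ m : ℤ × (Fin 3 → ℤ), (N : ℝ) ^ 2 < freqNormSq m.2 → c m = 0) →
      RapidDecay (fun K : Fin 4 → ℤ => c (K 0, Fin.tail K)) → ∀ k : Fin 3 → ℤ,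
      Summable fun n : ℤ => ‖(WithLp.toLp 2 (fun p : Fin 3 => ∑ j : Fin 3, ∑' m' : ℤ × (Fin 3 → ℤ),
        c m' j * (dsym j (((n, k) : ℤ × (Fin 3 → ℤ)).2 - m'.2) * c ((n, k) - m') p)) : EuclideanSpace ℂ (Fin 3))‖) ∧
    (∀ {c : ℤ × (Fin 3 → ℤ) → EuclideanSpace ℂ (Fin 3)} {N : ℕ},
      (∀ m : ℤ × (Fin 3 → ℤ), (N : ℝ) ^ 2 < freqNormSq m.2 → c m = 0) →
      RapidDecay (fun K : Fin 4 → ℤ => c (K 0, Fin.tail K)) → ∀ (x : UnitAddCircle) (k : Fin 3 → ℤ),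
      (∑' n : ℤ, (fourier n x : ℂ) • (WithLp.toLp 2 (fun p : Fin 3 => ∑ j : Fin 3, ∑' m' : ℤ × (Fin 3 → ℤ),
        c m' j * (dsym j (((n, k) : ℤ × (Fin 3 → ℤ)).2 - m'.2) * c ((n, k) - m') p)) : EuclideanSpace ℂ (Fin 3))) =
      Torus.convectionCoeff (freqBall N) (fun l : Fin 3 → ℤ => ∑' n : ℤ, (fourier n x : ℂ) • c (n, l))
        (fun l : Fin 3 → ℤ => ∑' n : ℤ, (fourier n x : ℂ) • c (n, l)) k) :=
  ⟨fun hcN hcr k => summable_norm_nl_fibre hcN hcr k,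
    fun hcN hcr x k => tsum_fourier_smul_nl_eq_convectionCoeff hcN hcr x k⟩

end Lattice

end Summit.AnomalousDissipation.AnomalousDissipation.Theorems.UniformWorkFloorTrap.WorkLipschitzCycles

end
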